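import Literature.AnabelianGeometry.EtaleTheta.SettingGaloisFacts
import Literature.NumberTheory.GaloisRepresentations.LocalGlobalCohomologyFiniteProofs
import Literature.NumberTheory.GaloisRepresentations.LocalFieldFiniteExtension
import Literature.NumberTheory.GaloisRepresentations.LocalFieldPadicProofs
import Mathlib.FieldTheory.Galois.Infinite

/-!
# [EtTh] §1: Krull-openness of `G_{K_N}`, `G_{J_N}`, `G_{J̈_N}` in `Gal(ℚ̄_p/ℚ_p)` and the open normal subgroups of `G_{ℚ_p}` (pp. 13–14, 17 / PDF pp. 13–14, 17 of §1)

Mochizuki, *The étale theta function …*, Publ. RIMS **45** (2009), §1: "`K_N := K(ζ_N, q_X^{1/N})`" (p.239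
(PDF p.13)), "`J_N := K_N(a^{1/N})_{a ∈ K_N}` … [note that `K_N^×/(K_N^×)^N`, hence also `Gal(J_N/K_N)`, is finite]"
(p.240 (PDF p.14)), "`J̈_N := K̈_N(a^{1/N})_{a ∈ K̈_N}`, where `K̈_N := K_{2N}`" (p.243 (PDF p.17))
[cite: MochizukiEtTh2009, §1 p.240 (PDF p.14)].  Layer L2 of the abc-iut cell, seat abc-iut-L2-t11 (gen 3); row
R110 «R78 F3b» of abc-iut-L2-lead (gen 3) — the Krull-topology plumbing the χ-twisted model of the §1 setting (R78:
`Π^tp_X := H ⋊_χ G_{ℚ_p}` with `G_{ℚ_p}` PROFINITELY topologised, builders abc-iut-L6-d6 / abc-iut-w5-d249 /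
abc-iut-w5-d091) needs in order to discharge the openness axioms `isOpen_GtpYN` / `isOpen_GtpZN` of `ThetaSetting`
(at the discrete root model these were `isOpen_discrete`).  PROOF-ONLY (no definition, no named fact; nothing
landed is edited; abc-iut-L2-t1's `SettingGaloisFacts.lean` proves the `K_N` half — `finiteDimensional_fieldKN`,
`isOpen_GKN` — and lists the `J_N` half under "NOT proved here: finiteness of `J_N/K_N` (`K_N^×/(K_N^×)^N`
finite)"; that finiteness is local-field theory available in the tree and is supplied here BY NAME).

* `isOpen_fixingSubgroup_fieldKN` — `G_{K_N}` is open in `G_{ℚ_p}` (`K`-indexed twin of `ThetaSetting.isOpen_GKN`).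
* `IntermediateField.finite_units_quotient_range_powMonoidHom` — **`E^×/(E^×)^n` is finite for a finite
  `E ⊆ ℚ̄_p` over `ℚ_p`** (print's bracket "[note that `K_N^×/(K_N^×)^N` … is finite]"): the tree's
  `finite_quotient_range_powMonoidHom_units` (Serre, *Cohomologie galoisienne* II §5.1 (a), for Mathlib's
  `IsNonarchimedeanLocalField`) at `E` made a non-archimedean local field by
  `FiniteExtension.isNonarchimedeanLocalField` (Serre, *Local Fields* II §2 Prop. 3) over
  `Padic.isNonarchimedeanLocalField_holds`.
* `finiteDimensional_adjoin_pow_mem` — adjoining to a finite `E` ALL `n`-th roots of ALL its elements gives a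
  finite extension (finitely many classes in `E^×/(E^×)^n`, at most `n` roots per representative); hence
  `finiteDimensional_fieldJN`, `finiteDimensional_fieldJddN`, `isOpen_fixingSubgroup_fieldJN`,
  `isOpen_fixingSubgroup_fieldJddN`, and the `D`-indexed `ThetaSetting.isOpen_GJN` / `isOpen_GJddN`.
* `GQp.exists_normal_fixingSubgroup_subset_of_mem_nhds` — the open NORMAL subgroups `Gal(ℚ̄_p/E)`, `E/ℚ_p`
  finite Galois, form a neighbourhood basis of `1` in `G_{ℚ_p}` (Mathlib `krullTopology_mem_nhds_one_iff_of_normal`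
  + `InfiniteGalois.normal_iff_isGalois`).
HONEST FRAMING: classical Galois / local-field facts about `ℚ̄_p/ℚ_p`; nothing of [EtTh] is asserted; no side is
taken on anything downstream ([IUTchIII] Cor. 3.12).
-/

noncomputable section

namespace Literature.AnabelianGeometry.EtaleTheta

open Literature.AnabelianGeometry.SemiGraphs IntermediateField Polynomial
open scoped Topology

variable {p : ℕ} [Fact p.Prime]

/-! ### `E^×/(E^×)^n` is finite for a finite extension `E` of `ℚ_p` inside `ℚ̄_p` -/

/-- **`L^×/(L^×)^n` is finite for a finite extension `L` of `ℚ_p`** (`n ≠ 0` in `L`) — print, p.240 (PDF p.14):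
"[note that `K_N^×/(K_N^×)^N`, hence also `Gal(J_N/K_N)`, is finite]".  The tree's local-field theorem
`finite_quotient_range_powMonoidHom_units` (`L^× = π^ℤ · 𝒪^×`, `𝒪^×/(𝒪^×)^n` finite) for Mathlib's
`IsNonarchimedeanLocalField`, at `L` equipped with the extended absolute value of `ℚ_p`
(`FiniteExtension.normedField/valuativeRel/isNonarchimedeanLocalField`, `Padic.isNonarchimedeanLocalField_holds`).
[cite: MochizukiEtTh2009, §1 p.240 (PDF p.14)] -/
theorem finite_units_quotient_range_powMonoidHom_of_finiteDimensional (L : Type*) [Field L] [Algebra ℚ_[p] L]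
    [FiniteDimensional ℚ_[p] L] {n : ℕ} (hn : (n : L) ≠ 0) :
    Finite (Lˣ ⧸ (powMonoidHom n : Lˣ →* Lˣ).range) := by
  haveI : IsNonarchimedeanLocalField ℚ_[p] :=
    Literature.NumberTheory.GaloisRepresentations.Padic.isNonarchimedeanLocalField_holds p
  letI := Literature.NumberTheory.GaloisRepresentations.FiniteExtension.normedField ℚ_[p] L
  letI := Literature.NumberTheory.GaloisRepresentations.FiniteExtension.valuativeRel ℚ_[p] L
  haveI : IsNonarchimedeanLocalField L :=
    Literature.NumberTheory.GaloisRepresentations.FiniteExtension.isNonarchimedeanLocalField ℚ_[p] L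
  exact Literature.NumberTheory.GaloisRepresentations.finite_quotient_range_powMonoidHom_units L n hn

/-- **`E^×/(E^×)^n` is finite** for an intermediate field `E ⊆ ℚ̄_p` finite over `ℚ_p` and `n ≥ 1` (the form used
for `E := K_N`).  [cite: MochizukiEtTh2009, §1 p.240 (PDF p.14)] -/
theorem IntermediateField.finite_units_quotient_range_powMonoidHom (E : IntermediateField ℚ_[p] (PadicAlgCl p))
    [FiniteDimensional ℚ_[p] E] {n : ℕ} (hn : n ≠ 0) :
    Finite ((E)ˣ ⧸ (powMonoidHom n : (E)ˣ →* (E)ˣ).range) :=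
  finite_units_quotient_range_powMonoidHom_of_finiteDimensional (p := p) E (Nat.cast_ne_zero.mpr hn)

/-! ### Adjoining all `n`-th roots of all elements of a finite extension stays finite -/

section Fields

variable (K : IntermediateField ℚ_[p] (PadicAlgCl p)) (q : PadicAlgCl p)

/-- For `s ∈ ℚ̄_p`, the set of `n`-th roots of `s` is finite (`n ≥ 1`; roots of `X^n − s`). [folklore] -/
private theorem finite_setOf_pow_eq (n : ℕ+) (s : PadicAlgCl p) : ({y : PadicAlgCl p | y ^ (n : ℕ) = s}).Finite := by
  refine ((X ^ (n : ℕ) - C s).rootSet_finite (PadicAlgCl p)).subset fun y hy => ?_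
  rw [mem_rootSet]
  refine ⟨X_pow_sub_C_ne_zero n.pos s, ?_⟩
  have hy' : y ^ (n : ℕ) = s := hy
  simp [hy']

/-- **Adjoining ALL `n`-th roots of ALL elements of a finite `E ⊆ ℚ̄_p` gives a finite extension of `ℚ_p`**
(print, p.240 (PDF p.14): "`J_N := K_N(a^{1/N})_{a ∈ K_N}` … `K_N^×/(K_N^×)^N`, hence also `Gal(J_N/K_N)`, is
finite"): if `S` is a (finite) set of representatives of `E^×/(E^×)^n`, every `x` with `x^n = a ∈ E^×`,
`a = s · w^n`, is `y · w` with `y^n = s`, so the field is contained in `E(⁠n-th roots of S)`, finitely many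
algebraic generators.  [cite: MochizukiEtTh2009, §1 p.240 (PDF p.14)] -/
theorem finiteDimensional_adjoin_pow_mem (E : IntermediateField ℚ_[p] (PadicAlgCl p))
    [FiniteDimensional ℚ_[p] E] (n : ℕ+) :
    FiniteDimensional ℚ_[p] (adjoin ℚ_[p] ((E : Set (PadicAlgCl p)) ∪ {x | x ^ (n : ℕ) ∈ E})) := by
  classical
  set P : Subgroup (E)ˣ := (powMonoidHom (n : ℕ) : (E)ˣ →* (E)ˣ).range with hP
  haveI : Finite ((E)ˣ ⧸ P) := IntermediateField.finite_units_quotient_range_powMonoidHom E n.ne_zero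
  -- representatives of `E^×/(E^×)^n`, as elements of `ℚ̄_p`, and their `n`-th roots
  let reps : Set (PadicAlgCl p) :=
    Set.range fun c : (E)ˣ ⧸ P => (((Quotient.out c : (E)ˣ) : E) : PadicAlgCl p)
  have hreps : reps.Finite := Set.finite_range _
  let R : Set (PadicAlgCl p) := ⋃ s ∈ reps, {y : PadicAlgCl p | y ^ (n : ℕ) = s}
  have hR : R.Finite := hreps.biUnion fun s _ => finite_setOf_pow_eq n s
  haveI : Finite R := hR.to_subtype
  haveI : FiniteDimensional ℚ_[p] (adjoin ℚ_[p] R) :=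
    finiteDimensional_adjoin fun x _ => (Algebra.IsAlgebraic.isAlgebraic x).isIntegral
  -- the field is contained in `E ⊔ ℚ_p(R)`
  have hle : adjoin ℚ_[p] ((E : Set (PadicAlgCl p)) ∪ {x | x ^ (n : ℕ) ∈ E}) ≤ E ⊔ adjoin ℚ_[p] R := by
    rw [adjoin_le_iff]
    rintro x (hx | hx)
    · exact (le_sup_left : E ≤ E ⊔ adjoin ℚ_[p] R) hx
    · change x ^ (n : ℕ) ∈ E at hx
      by_cases h0 : x ^ (n : ℕ) = 0
      · rw [pow_eq_zero_iff n.ne_zero] at h0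
        rw [h0]
        exact zero_mem _
      · -- `x^n = a = s · w^n` with `s` a representative and `w ∈ E^×`
        have ha0 : (⟨x ^ (n : ℕ), hx⟩ : E) ≠ 0 := fun h => h0 (by simpa using congrArg Subtype.val h)
        let au : (E)ˣ := Units.mk0 ⟨x ^ (n : ℕ), hx⟩ ha0
        obtain ⟨w, hw⟩ : (Quotient.out (QuotientGroup.mk (s := P) au))⁻¹ * au ∈ P := by
          rw [← QuotientGroup.eq, QuotientGroup.out_eq']
        set s : (E)ˣ := Quotient.out (QuotientGroup.mk (s := P) au) with hs
        have hsw : au = s * w ^ (n : ℕ) := by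
          rw [← powMonoidHom_apply, hw, mul_inv_cancel_left]
        have hw0 : ((w : E) : PadicAlgCl p) ≠ 0 := by
          simp only [ne_eq, ZeroMemClass.coe_eq_zero, Units.ne_zero, not_false_eq_true]
        -- `y := x / w` is an `n`-th root of the representative `s`
        have hy : (x / ((w : E) : PadicAlgCl p)) ^ (n : ℕ) = ((s : E) : PadicAlgCl p) := by
          rw [div_pow, div_eq_iff (pow_ne_zero _ hw0)]
          have h1 := congrArg (fun u : (E)ˣ => ((u : E) : PadicAlgCl p)) hsw
          simp only [Units.val_mul, Units.val_pow_eq_pow_val, MulMemClass.coe_mul, SubmonoidClass.coe_pow] at h1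
          exact h1
        have hyR : x / ((w : E) : PadicAlgCl p) ∈ R :=
          Set.mem_biUnion (Set.mem_range_self _) hy
        have hx' : x = x / ((w : E) : PadicAlgCl p) * ((w : E) : PadicAlgCl p) := (div_mul_cancel₀ x hw0).symm
        rw [hx']
        exact mul_mem ((le_sup_right : adjoin ℚ_[p] R ≤ E ⊔ adjoin ℚ_[p] R) (subset_adjoin ℚ_[p] R hyR))
          ((le_sup_left : E ≤ E ⊔ adjoin ℚ_[p] R) (w : E).2)
  exact FiniteDimensional.of_injective (IntermediateField.inclusion hle).toLinearMap
    (IntermediateField.inclusion_injective hle)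

/-- **`K_N/ℚ_p` finite ⇒ `G_{K_N}` is open in `G_{ℚ_p}`** (Krull topology; `K`-indexed twin of abc-iut-L2-t1's
`ThetaSetting.isOpen_GKN`).  [cite: MochizukiEtTh2009, §1 p.239 (PDF p.13)] -/
theorem isOpen_fixingSubgroup_fieldKN [FiniteDimensional ℚ_[p] K] (N : ℕ+) :
    IsOpen ((fieldKN K q N).fixingSubgroup : Set (GQp p)) := by
  haveI := finiteDimensional_fieldKN K q N
  exact (fieldKN K q N).fixingSubgroup_isOpen

/-- **`J_N/ℚ_p` is finite** ("`K_N^×/(K_N^×)^N`, hence also `Gal(J_N/K_N)`, is finite", p.240 (PDF p.14)).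
[cite: MochizukiEtTh2009, §1 p.240 (PDF p.14)] -/
theorem finiteDimensional_fieldJN [FiniteDimensional ℚ_[p] K] (N : ℕ+) :
    FiniteDimensional ℚ_[p] (fieldJN K q N) := by
  haveI := finiteDimensional_fieldKN K q N
  exact finiteDimensional_adjoin_pow_mem (fieldKN K q N) N

/-- **`J̈_N/ℚ_p` is finite** (`J̈_N := K̈_N(a^{1/N})_{a ∈ K̈_N}`, `K̈_N := K_{2N}`, p.243 (PDF p.17)).
[cite: MochizukiEtTh2009, §1 p.243 (PDF p.17)] -/
theorem finiteDimensional_fieldJddN [FiniteDimensional ℚ_[p] K] (N : ℕ+) :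
    FiniteDimensional ℚ_[p] (fieldJddN K q N) := by
  haveI := finiteDimensional_fieldKN K q (2 * N)
  exact finiteDimensional_adjoin_pow_mem (fieldKN K q (2 * N)) N

/-- **`G_{J_N}` is open in `G_{ℚ_p}`** (Krull topology).  [cite: MochizukiEtTh2009, §1 p.240 (PDF p.14)] -/
theorem isOpen_fixingSubgroup_fieldJN [FiniteDimensional ℚ_[p] K] (N : ℕ+) :
    IsOpen ((fieldJN K q N).fixingSubgroup : Set (GQp p)) := by
  haveI := finiteDimensional_fieldJN K q N
  exact (fieldJN K q N).fixingSubgroup_isOpen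

/-- **`G_{J̈_N}` is open in `G_{ℚ_p}`** (Krull topology).  [cite: MochizukiEtTh2009, §1 p.243 (PDF p.17)] -/
theorem isOpen_fixingSubgroup_fieldJddN [FiniteDimensional ℚ_[p] K] (N : ℕ+) :
    IsOpen ((fieldJddN K q N).fixingSubgroup : Set (GQp p)) := by
  haveI := finiteDimensional_fieldJddN K q N
  exact (fieldJddN K q N).fixingSubgroup_isOpen

end Fields

/-! ### `D`-indexed corollaries for a theta setting -/

namespace ThetaSetting

variable (D : ThetaSetting p)

/-- `G_{J_N} ≤ G_{ℚ_p}` is open, for every theta setting `D` (companion of `isOpen_GKN`).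
[cite: MochizukiEtTh2009, §1 p.240 (PDF p.14)] -/
theorem isOpen_GJN (N : ℕ+) : IsOpen (D.GJN N : Set (GQp p)) := by
  haveI := D.finiteDimensional_K
  exact isOpen_fixingSubgroup_fieldJN D.K D.qX N

/-- `G_{J̈_N} ≤ G_{ℚ_p}` is open, for every theta setting `D`.  [cite: MochizukiEtTh2009, §1 p.243 (PDF p.17)] -/
theorem isOpen_GJddN (N : ℕ+) : IsOpen (D.GJddN N : Set (GQp p)) := by
  haveI := D.finiteDimensional_K
  exact isOpen_fixingSubgroup_fieldJddN D.K D.qX N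

end ThetaSetting

/-! ### Open normal subgroups form a neighbourhood basis of `1` in `G_{ℚ_p}` -/

/-- **Every neighbourhood of `1` in `G_{ℚ_p} = Gal(ℚ̄_p/ℚ_p)` contains an OPEN NORMAL subgroup `Gal(ℚ̄_p/E)`, `E/ℚ_p`
finite Galois** (Krull topology; Mathlib `krullTopology_mem_nhds_one_iff_of_normal`, normality of `Gal(ℚ̄_p/E)` ⟺
`E/ℚ_p` Galois by `InfiniteGalois.normal_iff_isGalois`) — the input for the joint continuity of the action of
`G_{ℚ_p}` in a semidirect product `H ⋊_χ G_{ℚ_p}` with profinitely topologised Galois factor.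
[cite: NeukirchANT1999, Ch. IV §1] -/
theorem GQp.exists_normal_fixingSubgroup_subset_of_mem_nhds {U : Set (GQp p)} (hU : U ∈ 𝓝 (1 : GQp p)) :
    ∃ E : IntermediateField ℚ_[p] (PadicAlgCl p), FiniteDimensional ℚ_[p] E ∧ IsGalois ℚ_[p] E ∧
      E.fixingSubgroup.Normal ∧ IsOpen (E.fixingSubgroup : Set (GQp p)) ∧
        (E.fixingSubgroup : Set (GQp p)) ⊆ U := by
  haveI : IsGalois ℚ_[p] (PadicAlgCl p) := {}
  obtain ⟨E, hfin, hnorm, hsub⟩ := (krullTopology_mem_nhds_one_iff_of_normal ℚ_[p] (PadicAlgCl p) U).mp hU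
  haveI := hfin
  haveI := hnorm
  haveI : IsGalois ℚ_[p] E := {}
  exact ⟨E, hfin, this, (InfiniteGalois.normal_iff_isGalois E).mpr this, E.fixingSubgroup_isOpen, hsub⟩

end Literature.AnabelianGeometry.EtaleTheta

end
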